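import Summits.BirchSwinnertonDyer.Rank1Residual.X11b.RouteR1LogOmega
import Literature.NumberTheory.EllipticCurves.HeegnerPointReflectionHolds
import HarnessLib

/-!
# X2c / road LZZ, glue helper: `(log_{ω_E} σP)² = (log_{ω_E} P)²` for a HEEGNER point `P` and the
# non-trivial automorphism `σ` of `K` — rank-free (cell `bsd-eis`, seat `bsd-eis-cgshw` g14; route
# `EisensteinPrimes`, crux 4 `BSDpOnCellC` = stmt-BirchSwinnertonDyer-19034, COMMISSION (O2)-LZZ@3: the «∀ ι_K»
# step of the implication FACT (p509230) ⟹ `X2.LZZRoadInput` / `X2.LZZRoadCore`, lit AUDIT (2b) (I))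

HONEST FRAMING (cell `bsd-eis`): THEOREMS ONLY; nothing booked; X2 stays CONSTRUCTION-SHAPED; no label or count
moves. The typed inputs `X2.LZZRoadInput` / `X2.LZZRoadCore` quantify over EVERY complex embedding `ι_K` with
`ι_K(P) = P_K`, while the Literature fact `LiuZhangZhang2018.thm151_thm153_modularCurve_heegnerVector` (p509230)
wants the embedding inducing the distinguished `𝔭`. For the other embedding `ι_K ∘ σ` one applies the fact to
`σP` (same complex image) and transports the value clause (L2) back with THIS file: by the tree theorem
`heegnerPoint_conj_add_rootNumber_smul_holds` (Darmon 2004 Prop. 3.11 / Gross 1984: `σP + w(E)•P` is torsion for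
a Heegner point `P`) and the additivity of `log_{ω_E}` (which kills torsion), `log_{ω_E}(σP) = −w(E)·log_{ω_E} P`,
so the squares agree (`w(E) = ±1`). Unlike `X11b.R1.sq_logOmega_map_eq_of_rank_one` no rank hypothesis is used.

References: [Darmon2004] Prop. 3.11; [SilvermanAEC2009] IV.6.4; lit AUDIT 2026-08-27T07:43Z (2b) (I); cgshw MEMO-18 §9 (I).
-/

set_option autoImplicit false

noncomputable section

open scoped Classical

open WeierstrassCurve NumberField Literature.NumberTheory.EllipticCurves
  Literature.NumberTheory.EllipticCurves.Castella2018
  Summit.BirchSwinnertonDyer.Rank1Residual.X11b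
  Summit.BirchSwinnertonDyer.Rank1Residual.X11b.Halves

namespace Summit.BirchSwinnertonDyer.Rank1Residual.X2

variable (W : WeierstrassCurve ℚ) [W.IsElliptic] [W.IsGloballyMinimal] [NeZero (W.conductorNorm ℤ)]
  (p : ℕ) [Fact p.Prime] {K : Type} [Field K] [NumberField K]

/-- **`log_{ω_E}(σP) = −w(E)·log_{ω_E}(P)`** for a Heegner point `P ∈ E(K)` of level `N_E` and the non-trivial
`σ : K →ₐ[ℚ] K`, along any `ι : K → ℚ_p`: `σP + w(E)•P` is torsion (`heegnerPoint_conj_add_rootNumber_smul_holds`)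
and `log_{ω_E}` is additive and vanishes on torsion (`X11b.R1.logOmega_eq_padicLog`,
`Additive.LocalLog.padicLog_eq_zero_iff`). [cite: Darmon2004, Prop. 3.11] [cite: SilvermanAEC2009, IV.6.4] -/
theorem logOmega_map_eq_neg_rootNumber_mul_of_isHeegnerPoint (hK : IsImaginaryQuadratic K)
    (hH : SatisfiesHeegnerHypothesis (W.conductorNorm ℤ) K) {P : (W.baseChange K).toAffine.Point}
    (hP : IsHeegnerPoint (W.conductorNorm ℤ) W K P) {σ : K →ₐ[ℚ] K} (hσ : σ ≠ AlgHom.id ℚ K)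
    (ι : K →+* ℚ_[p]) :
    logOmega W p ι (WeierstrassCurve.Affine.Point.map (W' := W) σ P) =
      -(W.rootNumber : ℚ_[p]) * logOmega W p ι P := by
  have htors := heegnerPoint_conj_add_rootNumber_smul_holds W K hK hH hP σ hσ
  set g : (W.baseChange K).toAffine.Point →+ (W.baseChange ℚ_[p]).toAffine.Point :=
    WeierstrassCurve.Affine.Point.map ι.toRatAlgHom with hg
  have hread : ∀ Q, logOmega W p ι Q = Additive.LocalLog.padicLog (W.baseChange ℚ_[p]) (g Q) :=
    fun Q ↦ R1.logOmega_eq_padicLog W p ι Q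
  have hkill : Additive.LocalLog.padicLog (W.baseChange ℚ_[p])
      (g (WeierstrassCurve.Affine.Point.map (W' := W) σ P + W.rootNumber • P)) = 0 :=
    (Additive.LocalLog.padicLog_eq_zero_iff _ _).mpr (g.isOfFinAddOrder htors)
  rw [map_add, map_zsmul, map_add, map_zsmul, zsmul_eq_mul] at hkill
  rw [hread, hread]
  linear_combination hkill

/-- **`(log_{ω_E} σP)² = (log_{ω_E} P)²`** for a Heegner point `P` and the non-trivial automorphism `σ` of `K`
(`w(E)² = 1`). The «∀ ι_K» step of FACT ⟹ `X2.LZZRoadInput`/`X2.LZZRoadCore` (clause (L2) only sees this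
square). [cite: Darmon2004, Prop. 3.11] [cite: SilvermanAEC2009, IV.6.4] -/
theorem sq_logOmega_map_eq_of_isHeegnerPoint (hK : IsImaginaryQuadratic K)
    (hH : SatisfiesHeegnerHypothesis (W.conductorNorm ℤ) K) {P : (W.baseChange K).toAffine.Point}
    (hP : IsHeegnerPoint (W.conductorNorm ℤ) W K P) {σ : K →ₐ[ℚ] K} (hσ : σ ≠ AlgHom.id ℚ K)
    (ι : K →+* ℚ_[p]) :
    logOmega W p ι (WeierstrassCurve.Affine.Point.map (W' := W) σ P) ^ 2 = logOmega W p ι P ^ 2 := by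
  rw [logOmega_map_eq_neg_rootNumber_mul_of_isHeegnerPoint W p hK hH hP hσ ι]
  rcases rootNumber_eq_one_or_eq_neg_one W with h | h <;> rw [h] <;> push_cast <;> ring

/-- The same for `padicLogOmega` (`= logOmega` definitionally), the symbol of `X2.LZZRoadInput`'s clause (L2).
[cite: Darmon2004, Prop. 3.11] -/
theorem sq_padicLogOmega_map_eq_of_isHeegnerPoint (hK : IsImaginaryQuadratic K)
    (hH : SatisfiesHeegnerHypothesis (W.conductorNorm ℤ) K) {P : (W.baseChange K).toAffine.Point}
    (hP : IsHeegnerPoint (W.conductorNorm ℤ) W K P) {σ : K →ₐ[ℚ] K} (hσ : σ ≠ AlgHom.id ℚ K)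
    (ι : K →+* ℚ_[p]) :
    padicLogOmega W p ι (WeierstrassCurve.Affine.Point.map (W' := W) σ P) ^ 2 = padicLogOmega W p ι P ^ 2 :=
  sq_logOmega_map_eq_of_isHeegnerPoint W p hK hH hP hσ ι

end Summit.BirchSwinnertonDyer.Rank1Residual.X2

end
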